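import Literature.NumberTheory.PAdicHodge.FontaineDpst
import Literature.NumberTheory.GaloisRepresentations.CrystallineDeformationRing
import Literature.NumberTheory.GaloisRepresentations.OrdinaryRegular
import Literature.NumberTheory.EllipticCurves.FramedTateGaloisRep
import Literature.NumberTheory.DiophantineGeometry.LocalReduction
import Literature.NumberTheory.GaloisRepresentations.LocalKroneckerWeberInertiaProofs
import HarnessLib

/-!
# Stub-ideation k = 3, GENERATION 14 (home family 3 = PROBE THE EXTREMES) for `stub_liftThree`
# of crux `FreyModularity` (stmt-ABC-11340, route ABC/DefiniteXi, line `Lines/Sketch.lean`, sha 21576c53)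

Companion of `STUB-IDEAS-stub_liftThree-3.md` (gen 14).  Imports LANDED `Literature` modules only (no
`Cruxes/` module; the accepted cross-summit theorem
`Summit.Langlands.Langlands.Theorems.EmptyWeightCore.Negative.exists_twin_fontainePstAdicCompletion_isCrystallineFramed_imp_isLocallyUnramified`
is not in the ABC farm snapshot, so its conclusion is carried VERBATIM as the `Prop` `PinTwin v ℓ hv`,
discharged by that theorem by name); kernel status: NO `sorry`; helper STATEMENTS are `def … : Prop`,
every `theorem` is proved.

**The move (degenerate witness on the CURRENCY, not on the curve).**  Gens 11–13 (k3) and gen 13 (k1,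
socket `DiamondCSS62 ℓ`) type the FLAT branch at `v ∣ ℓ` — the α-cell of the consumption census
(supersingular / good reduction at `3`) — as
`(fontainePstAdicCompletion v ℓ hv).IsCrystallineFramed ((W.framedTateGaloisRep ℓ).toLocal v)`, i.e. over
THE `ε`-pinned datum (`fontainePst = Classical.epsilon …`).  The extreme instance of that currency is the
accepted TWIN datum of `Summit.Langlands…EmptyWeightCore.Negative`: same `ℚ_ℓ`-structure, same period
ring, and `IsCrystallineFramed ρ → ρ.IsLocallyUnramified` in rank `≥ 2`.  Since `ρ_{W,ℓ}|Γ_{ℚ_v}` is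
ramified (`det = χ_ℓ`), the curve-side provider `CrysOfGood ℓ` (k1-g13) = H1 (k3-g11) FAILS for the
twin (`exists_twin_not_goodReductionCrystallineAt`), hence is not certifiable by any argument uniform in
`ε`; and by the census in the module docstring of `FontaineDpst` ((F14), "clauses (F1)–(F13) produce
`𝔇`-crystallinity only for unramified representations and the cyclotomic character") plus the weight
irregularity `λ ≡ -1` of `V_ℓ E` for (F14) (`not_regular_of_forall_eq`), it is not derivable from
`FontaineDatumExists` either.  So, AS TYPED, it is dischargeable only by a CLAUSE ADDITION (F15) — the
predicate `GoodReductionCrystallineAt` below, predicated of the pin (`F15Pinned`), from which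
`CrysOfGood ℓ` is one line (`crysOfGood_of_f15Pinned`) — exactly the precedent of (F14)
(`GeeGeraghty2012.crystalline_of_ordinary_regular` → clause).
-/

noncomputable section

open scoped MatrixGroups NumberField
open NumberField IsDedekindDomain IsDedekindDomain.HeightOneSpectrum
open Literature.NumberTheory Literature.NumberTheory.GaloisRepresentations
open Literature.NumberTheory.EllipticCurves Literature.NumberTheory.PAdicHodge
open WeierstrassCurve Field

namespace Summit.ABC.ABC.Cruxes.FreyModularity.StubIdeas.LiftThree3g14

universe u

/-! ## §0 The currency under audit (k1-g13 `CrysOfGood`, verbatim body; = k3-g11 H1 at `K = ℚ`) -/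

/-- **CRYS `CrysOfGood ℓ`** (k1-liftThree-g13, verbatim): good reduction at `v ∣ ℓ` ⇒ `ρ_{W,ℓ}|Γ_{ℚ_v}`
is crystalline with Hodge–Tate weights in `[-1,0]` FOR THE PINNED DATUM `fontainePstAdicCompletion v ℓ hv`.
[cite: Conrad1997Flat, Thm. 1.2] [cite: Faltings1989Crystalline, §5] -/
def CrysOfGood (ℓ : ℕ) [Fact ℓ.Prime] : Prop :=
  ∀ (W : WeierstrassCurve ℚ) [W.IsElliptic] (v : HeightOneSpectrum (𝓞 ℚ))
    (hv : ((ℓ : ℕ) : 𝓞 ℚ) ∈ v.asIdeal), W.HasGoodReductionAt v →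
    (fontainePstAdicCompletion v ℓ hv).IsCrystallineFramed ((W.framedTateGaloisRep ℓ).toLocal v) ∧
      (fontainePstAdicCompletion v ℓ hv).IsDeRhamWithWeightsIn (-1) 0
        ((W.framedTateGaloisRep ℓ).toLocal v)

/-! ## §1 (F15-EC) — the clause shape: the same body predicated of an ABSTRACT datum at `v ∣ ℓ` -/

/-- **H14.3 / clause proposal (F15-EC), place form.**  For a datum `𝔇` on `K_v`, `v ∣ ℓ`: every
elliptic curve over the number field `K` with good reduction at `v` has `ρ_{W,ℓ}|Γ_{K_v}`
`𝔇`-crystalline with Hodge–Tate weights in `[-1,0]` (tree convention `HT(χ_ℓ) = -1`).  For the GENUINE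
datum: Fontaine 1982 §5 / Faltings 1989 §5 / Tsuji 1999 Thm. 0.2 (`C_cris` for the abelian scheme
`ℰ/𝒪_{K_v}`), or Breuil 2000 / Kisin 2006 Cor. 2.2.6 (`ℓ`-divisible groups ⟺ crystalline `[0,1]`).
[cite: Faltings1989Crystalline, §5] [cite: Tsuji1999Cst, Thm. 0.2] [cite: Kisin2006FCrystals, Cor. 2.2.6] -/
def GoodReductionCrystallineAt {K : Type} [Field K] [NumberField K] (v : HeightOneSpectrum (𝓞 K))
    (ℓ : ℕ) [Fact ℓ.Prime] (𝔇 : PstWeilDeligneData (v.adicCompletion K) ℓ) : Prop :=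
  ∀ (W : WeierstrassCurve K) [W.IsElliptic], W.HasGoodReductionAt v →
    𝔇.IsCrystallineFramed ((W.framedTateGaloisRep ℓ).toLocal v) ∧
      𝔇.IsDeRhamWithWeightsIn (-1) 0 ((W.framedTateGaloisRep ℓ).toLocal v)

/-- **(F15) predicated of THE pin at every place of every number field** — the body a named fact
`…crystalline_of_goodReduction` would have, and what `FontaineDatumExists.pinned…` would give in one
line once (F15) is a clause of `IsFontaineDatum` (Upgrade path, as (F13)/(F14)). [folklore] -/
def F15Pinned : Prop :=
  ∀ (K : Type) [Field K] [NumberField K] (v : HeightOneSpectrum (𝓞 K)) (ℓ : ℕ) [Fact ℓ.Prime]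
    (hv : ((ℓ : ℕ) : 𝓞 K) ∈ v.asIdeal), GoodReductionCrystallineAt v ℓ (fontainePstAdicCompletion v ℓ hv)

/-- `CrysOfGood ℓ` is the `K = ℚ` slice of "(F15) for the pin" (binder shuffle). [folklore] -/
theorem crysOfGood_iff_pinned (ℓ : ℕ) [Fact ℓ.Prime] :
    CrysOfGood ℓ ↔ ∀ (v : HeightOneSpectrum (𝓞 ℚ)) (hv : ((ℓ : ℕ) : 𝓞 ℚ) ∈ v.asIdeal),
      GoodReductionCrystallineAt v ℓ (fontainePstAdicCompletion v ℓ hv) :=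
  ⟨fun h v hv W _ hW => h W v hv hW, fun h W _ v hv hW => h v hv W hW⟩

/-- (PROVED glue) (F15)-for-the-pin ⇒ `CrysOfGood ℓ`, one line. [folklore] -/
theorem crysOfGood_of_f15Pinned (ℓ : ℕ) [Fact ℓ.Prime] (h : F15Pinned) : CrysOfGood ℓ :=
  (crysOfGood_iff_pinned ℓ).2 fun v hv => h ℚ v ℓ hv

/-! ## §2 The degenerate witness: the TWIN of the pin refutes the body of `CrysOfGood` -/

/-- **H14.1 `TateLocalRamified ℓ` (S).**  `ρ_{W,ℓ}|Γ_{ℚ_v}` is ramified at `v ∣ ℓ` (its determinant is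
`χ_ℓ|Γ_{ℚ_v}`, infinitely ramified).  Ingredients in the tree: `det_framedTateGaloisRep_eq_cyclotomic`
(k1-g13 companion, proved, unlanded), `cyclotomicCharacter_absGaloisRestrict`
(`LocalKroneckerWeberInertiaProofs`), `not_isLocallyUnramified_cyclotomic` (`SoloInformedPstSpecTwist`).
[cite: SerreAbelianLadic1968, Ch. I §1.2; Ch. IV §1] [cite: SilvermanAEC2009, III.8.3, V.?] -/
def TateLocalRamified (ℓ : ℕ) [Fact ℓ.Prime] : Prop :=
  ∀ (W : WeierstrassCurve ℚ) [W.IsElliptic] (v : HeightOneSpectrum (𝓞 ℚ)),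
    ((ℓ : ℕ) : 𝓞 ℚ) ∈ v.asIdeal → ¬ ((W.framedTateGaloisRep ℓ).toLocal v).IsLocallyUnramified

/-- **DET `DetCyclotomic ℓ`** — `det ρ_{W,ℓ}(σ) = χ_ℓ(σ)` in `ℚ̄_ℓ`: PROVED by k2-liftFive-g11 / k1-g13
(`det_framedTateGaloisRep_eq_cyclotomic`, companion `STUB_IDEAS_stub_liftThree_1g13.lean`, 0 sorries;
statement verbatim), cited as a `Prop` since crux workfiles do not import one another.
[cite: SilvermanAEC2009, III.8.3] -/
def DetCyclotomic (ℓ : ℕ) [Fact ℓ.Prime] : Prop :=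
  ∀ (W : WeierstrassCurve ℚ) [W.IsElliptic] (σ : absoluteGaloisGroup ℚ),
    ((W.framedTateGaloisRep ℓ σ : GL (Fin 2) (PadicAlgCl ℓ)) : Matrix (Fin 2) (Fin 2) (PadicAlgCl ℓ)).det =
      algebraMap ℚ_[ℓ] (PadicAlgCl ℓ) (PadicInt.Coe.ringHom (p := ℓ)
        ((GaloisRep.cyclotomicCharacter ℚ ℓ σ : ℤ_[ℓ]ˣ) : ℤ_[ℓ]))

/-- `ℓ ∈ v ⇒ p_v = ℓ` (folklore; `Rat.HeightOneSpectrum.natGenerator_dvd_iff`). [folklore] -/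
theorem primesEquiv_eq_of_mem (ℓ : ℕ) [hℓ : Fact ℓ.Prime] (v : HeightOneSpectrum (𝓞 ℚ))
    (hv : ((ℓ : ℕ) : 𝓞 ℚ) ∈ v.asIdeal) : ((Rat.HeightOneSpectrum.primesEquiv v : Nat.Primes) : ℕ) = ℓ := by
  change Rat.HeightOneSpectrum.natGenerator v = ℓ
  rw [← Nat.prime_dvd_prime_iff_eq (Rat.HeightOneSpectrum.prime_natGenerator v) hℓ.out,
    Rat.HeightOneSpectrum.natGenerator_dvd_iff,
    ← map_natCast (Rat.IsIntegralClosure.intEquiv (𝓞 ℚ)) ℓ, Ideal.apply_mem_of_equiv_iff]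
  exact hv

/-- **H14.1 PROVED from DET** (`χ_ℓ(I_{ℚ_v}) = ℤ_ℓˣ ∋ -1`, tree theorem
`adicCompletion_rat_exists_mem_absInertia_cyclotomicCharacter_eq`; `χ_ℓ ∘ res = χ_ℓ`,
`cyclotomicCharacter_absGaloisRestrict`): an inertia element with `χ_ℓ = -1` has `det ρ_{W,ℓ} = -1 ≠ 1`.
[folklore] -/
theorem tateLocalRamified_of_detCyclotomic (ℓ : ℕ) [Fact ℓ.Prime] (hD : DetCyclotomic ℓ) :
    TateLocalRamified ℓ := by
  intro W _ v hv hu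
  obtain ⟨σ, hσ, hχ⟩ :=
    adicCompletion_rat_exists_mem_absInertia_cyclotomicCharacter_eq ℓ v (primesEquiv_eq_of_mem ℓ v hv) (-1)
  have h1 : ((W.framedTateGaloisRep ℓ).toLocal v) σ = 1 := hu σ hσ
  have hdet := hD W (absGaloisRestrict ℚ (v.adicCompletion ℚ) σ)
  rw [← FramedGaloisRep.toLocal_apply, h1, cyclotomicCharacter_absGaloisRestrict, hχ] at hdet
  simp only [Units.val_one, Matrix.det_one, Units.val_neg, Units.val_one, map_neg, map_one] at hdet
  have h2 : (2 : PadicAlgCl ℓ) = 0 := by linear_combination hdet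
  exact two_ne_zero h2

/-- **The accepted twin theorem, conclusion verbatim** (`Summit.Langlands.Langlands.Theorems.EmptyWeightCore.
Negative.exists_twin_fontainePstAdicCompletion_isCrystallineFramed_imp_isLocallyUnramified v ℓ hv`, file
`PinTwinNoRamifiedCrystalline.lean`, 0 sorries; carried as a `Prop` only because that module is outside the
ABC farm snapshot): a datum with the pin's `ℚ_ℓ`-structure and period ring declaring no ramified
rank-`≥ 2` representation of `Γ_{K_v}` crystalline. [folklore] -/
def PinTwin {K : Type} [Field K] [NumberField K] (v : HeightOneSpectrum (𝓞 K)) (ℓ : ℕ) [Fact ℓ.Prime]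
    (hv : ((ℓ : ℕ) : 𝓞 K) ∈ v.asIdeal) : Prop :=
  ∃ 𝔇 : PstWeilDeligneData (v.adicCompletion K) ℓ,
    𝔇.algebra = (fontainePstAdicCompletion v ℓ hv).algebra ∧
    HEq 𝔇.𝔅 (fontainePstAdicCompletion v ℓ hv).𝔅 ∧
    ∀ {n : ℕ}, 2 ≤ n →
      ∀ ρ : FramedRep (absoluteGaloisGroup (v.adicCompletion K)) (PadicAlgCl ℓ) n,
        𝔇.IsCrystallineFramed ρ → ρ.IsLocallyUnramified

/-- **H14.2 (PROVED from H14.1 + the accepted twin theorem).**  At every `v ∣ ℓ` there is a datum with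
the pin's `ℚ_ℓ`-structure and the pin's period ring (`HEq`, the only two invariants of `fontainePst` the
tree knows unconditionally) for which NO `ρ_{W,ℓ}|Γ_{ℚ_v}` is crystalline; in particular the body of
`CrysOfGood ℓ` / H1 / the flat branch of `IsSemistableAtEll` is FALSE for that datum as soon as one
curve has good reduction at `v`.  Hence no proof uniform over Hilbert's `ε` certifies `CrysOfGood ℓ`.
[folklore] -/
theorem exists_twin_forall_not_isCrystallineFramed (ℓ : ℕ) [Fact ℓ.Prime] (hT : TateLocalRamified ℓ)
    (v : HeightOneSpectrum (𝓞 ℚ)) (hv : ((ℓ : ℕ) : 𝓞 ℚ) ∈ v.asIdeal) (twin : PinTwin v ℓ hv) :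
    ∃ 𝔇 : PstWeilDeligneData (v.adicCompletion ℚ) ℓ,
      𝔇.algebra = (fontainePstAdicCompletion v ℓ hv).algebra ∧
      HEq 𝔇.𝔅 (fontainePstAdicCompletion v ℓ hv).𝔅 ∧
      ∀ (W : WeierstrassCurve ℚ) [W.IsElliptic],
        ¬ 𝔇.IsCrystallineFramed ((W.framedTateGaloisRep ℓ).toLocal v) := by
  obtain ⟨𝔇, halg, h𝔅, h⟩ := twin
  exact ⟨𝔇, halg, h𝔅, fun W _ hc => hT W v hv (h le_rfl _ hc)⟩

/-- **Corollary: (F15-EC) fails for a twin of the pin** (given one good-reduction curve at `v`).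
[folklore] -/
theorem exists_twin_not_goodReductionCrystallineAt (ℓ : ℕ) [Fact ℓ.Prime]
    (hT : TateLocalRamified ℓ) (v : HeightOneSpectrum (𝓞 ℚ)) (hv : ((ℓ : ℕ) : 𝓞 ℚ) ∈ v.asIdeal)
    (twin : PinTwin v ℓ hv) (W : WeierstrassCurve ℚ) [W.IsElliptic] (hW : W.HasGoodReductionAt v) :
    ∃ 𝔇 : PstWeilDeligneData (v.adicCompletion ℚ) ℓ,
      𝔇.algebra = (fontainePstAdicCompletion v ℓ hv).algebra ∧
      HEq 𝔇.𝔅 (fontainePstAdicCompletion v ℓ hv).𝔅 ∧ ¬ GoodReductionCrystallineAt v ℓ 𝔇 := by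
  obtain ⟨𝔇, halg, h𝔅, h⟩ := exists_twin_forall_not_isCrystallineFramed ℓ hT v hv twin
  exact ⟨𝔇, halg, h𝔅, fun hG => h W (hG W hW).1⟩

/-- **H14.5 `ToLocalBaseChangeConj` (M−, signature only).**  What a clause stated over a GENERAL local
field `F` (curves over `F` with unit-discriminant minimal model) needs in order to yield the place form
`GoodReductionCrystallineAt v ℓ 𝔇`: `ρ_{W,ℓ}|Γ_{K_v}` is conjugate to `ρ_{W ⊗ K_v, ℓ}` (Tate module
commutes with base change `K → K_v`; any two frames are conjugate,
`exists_conj_framedTateGaloisRep_eq_ofBasis`; crystallinity is frame invariant,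
`PstWeilDeligneData.isCrystallineFramed_conj_iff`). [cite: SilvermanAEC2009, III.7] -/
def ToLocalBaseChangeConj {K : Type} [Field K] [NumberField K] (v : HeightOneSpectrum (𝓞 K))
    (ℓ : ℕ) [Fact ℓ.Prime] : Prop :=
  ∀ (W : WeierstrassCurve K) [W.IsElliptic],
    letI := LocalField.charZero_adicCompletion v
    ∃ P : GL (Fin 2) (PadicAlgCl ℓ),
      (W.framedTateGaloisRep ℓ).toLocal v =
        FramedRep.conj P ((W.baseChange (v.adicCompletion K)).framedTateGaloisRep ℓ)

/-! ## §3 (F14) does not reach the α/γ cells: the Tate-module weight is irregular -/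

/-- **H14.4 (PROVED, bookkeeping).**  A labelled weight constant across the two rows — the ordinary
weight of `V_ℓ E` in the (F14) normalisation is `λ_{τ,1} = λ_{τ,2} = -1` (prescribed Hodge–Tate weights
`{λ_{τ,2}, λ_{τ,1} + 1} = {-1, 0}`) — is NOT regular in the sense of clause (F14)
(`isCrystallineFramed_of_ordinary_regular`: for consecutive rows some label with STRICT inequality).
So (F14) (Gee–Geraghty 2012, Lemma 3.1.4 (3)) never certifies crystallinity of `ρ_{W,ℓ}|Γ_{ℚ_v}` — rightly:
good-ordinary and multiplicative reduction have the same inertial diagonal `(χ_ℓ, 1)`.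
[cite: GeeGeraghty2012, Def. 3.1.2, Lemma 3.1.4 (3)] -/
theorem not_regular_of_forall_eq {L : Type u} [Field L] [TopologicalSpace L] {A : Type}
    [CommRing A] [TopologicalSpace A] (wt : LabelledWeight L A 2) (c : ℤ)
    (h : ∀ (τ : HodgeTateLabel L A) (i : Fin 2), wt τ i = c) :
    ¬ ∀ i j : Fin 2, (i : ℕ) + 1 = j → ∃ τ : HodgeTateLabel L A, wt τ j < wt τ i := by
  intro hreg
  obtain ⟨τ, hτ⟩ := hreg 0 1 (by simp)
  rw [h τ 1, h τ 0] at hτ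
  exact lt_irrefl _ hτ

end Summit.ABC.ABC.Cruxes.FreyModularity.StubIdeas.LiftThree3g14

end
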